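import Summits.AtomisticToContinuum.BoseEinsteinCondensation.Theses.BECVortexSheetPeierls
import Literature.Probability.LatticeModels.VillainCurrentDuality

/-!
# Route BECVortexSheetPeierls — `SpatialVillainLRO` from `HomogeneousVillainLRO`
# (item stmt-AtomisticToContinuum-13468 ⇐ item stmt-AtomisticToContinuum-13470)

The route's foreseen split "SpatialVillainLRO ⇐ HomogeneousVillainLRO → InhomogeneityByDuality"
with the middle child DISCHARGED: the inhomogeneity ratio `Λ` (and the arbitrary temporal
stiffnesses of the one-slice models `VillainCurrentModel 3 L 1`) are absorbed by Ginibre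
monotonicity of the Villain two-point function in every bond stiffness
(Aizenman–Harel–Peled–Shapiro 2021, Cor. 11.4 — PROVED in the tree, `pinnedVillainTwoPoint_mono`),
transported to the current side by the worm/rotor duality
(`VillainCurrentModel.twoPoint_eq_ofReal_villainTwoPoint`, `VillainCurrentModel.twoPoint_mono`,
`villainTwoPoint_congr_of_loops` of `Literature/Probability/LatticeModels/VillainCurrentDuality.lean`):

* given `P : VillainCurrentModel 3 L 1` with `K ≤ κ_b` on spatial bonds, lower every spatial
  stiffness to `K` (two-point functions decrease bond by bond) — the comparison model agrees with
  the homogeneous model `homogeneous (fun _ => K)` on all non-loop bonds (for `M = 1` the temporal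
  bonds `s → s + e_time = s` are loops), hence has the same two-point functions;
* so `∑_{x,y} P.twoPoint (x,0) (y,0) ≥ ∑_{x,y} (homogeneous K).twoPoint (x,0) (y,0) ≥ ofReal (c·L⁶)`
  for `K ≥ max K₀ 1` by `HomogeneousVillainLRO`; the upper bound `κ_b ≤ ΛK` is not used.

Hence `spatialVillainLRO_of_homogeneousVillainLRO : HomogeneousVillainLRO → SpatialVillainLRO`;
what remains of item 13468 is exactly item 13470 (Fröhlich–Spencer 1982 on the torus).
-/

noncomputable section

namespace Summit.AtomisticToContinuum.BoseEinsteinCondensation.Theorems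

open scoped ENNReal BigOperators
open Literature.Probability.LatticeModels Literature.Probability.LatticeModels.JCurrent
open Summit.AtomisticToContinuum.BoseEinsteinCondensation.Theses.BECVortexSheetPeierls

/-- On a one-slice space-time torus (`M = 1`) a bond which is not a loop is spatial: if
`b.1 ≠ b.1 + e_{b.2}` then `b.2 ≠ none` (the temporal unit vector `(0, 1)` vanishes in
`TorusSite d L × ZMod 1`). [folklore] -/
theorem bond_dir_ne_none_of_not_loop {d L : ℕ} (b : Bond d L 1) (hb : b.1 ≠ b.1 + unitVec b.2) :
    b.2 ≠ none := by
  rintro h2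
  apply hb
  rw [h2]
  ext i
  · simp [unitVec]
  · exact Subsingleton.elim _ _

/-- **`HomogeneousVillainLRO → SpatialVillainLRO`** (item stmt-AtomisticToContinuum-13468 reduced to
item stmt-AtomisticToContinuum-13470): uniform block long-range order of the homogeneous 3-D Villain
current model at every stiffness `β ≥ K₀` implies it, with the same constant `c` and threshold
`max K₀ 1`, for every bondwise stiffness field whose spatial values are `≥ K ≥ max K₀ 1` — by
Ginibre/AHPS monotonicity in the bond stiffnesses on the current side
(`VillainCurrentModel.twoPoint_mono`) and the loop-invariance of the two-point function (temporal
bonds of `VillainCurrentModel 3 L 1` are loops). The inhomogeneity ratio `Λ` plays no role.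
[cite: AizenmanHarelPeledShapiro2021, Cor. 11.4] -/
theorem spatialVillainLRO_of_homogeneousVillainLRO (h : HomogeneousVillainLRO) :
    SpatialVillainLRO := by
  intro Λ _
  obtain ⟨K₀, c, hc, H⟩ := h
  refine ⟨max K₀ 1, c, hc, ?_⟩
  intro L _ P K hK hb
  have hKpos : 0 < K := lt_of_lt_of_le one_pos (le_trans (le_max_right _ _) hK)
  have hK₀ : K₀ ≤ K := le_trans (le_max_left _ _) hK
  -- the comparison model: spatial stiffness `K`, temporal stiffness unchanged
  let Q : VillainCurrentModel 3 L 1 :=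
    ⟨fun b => if b.2 = none then P.stiffness b else K, fun b => by
      split_ifs
      · exact P.stiffness_pos b
      · exact hKpos⟩
  have hQP : ∀ b, Q.stiffness b ≤ P.stiffness b := fun b => by
    show (if b.2 = none then P.stiffness b else K) ≤ P.stiffness b
    split_ifs with h2
    · exact le_rfl
    · exact (hb b h2).1
  have hQH : ∀ x y : SpaceTimeSite 3 L 1, Q.twoPoint x y =
      (VillainCurrentModel.homogeneous (fun _ => K) (fun _ => hKpos) :
        VillainCurrentModel 3 L 1).twoPoint x y := by
    intro x y
    rw [VillainCurrentModel.twoPoint_eq_ofReal_villainTwoPoint,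
      VillainCurrentModel.twoPoint_eq_ofReal_villainTwoPoint]
    congr 1
    refine villainTwoPoint_congr_of_loops _ _ Q.stiffness_pos (fun _ => hKpos) (fun b hb' => ?_) x y
    show (if b.2 = none then P.stiffness b else K) = K
    rw [if_neg (bond_dir_ne_none_of_not_loop b hb')]
  calc ENNReal.ofReal (c * (L : ℝ) ^ 6)
      ≤ ∑ x : TorusSite 3 L, ∑ y : TorusSite 3 L,
          (VillainCurrentModel.homogeneous (fun _ => K) (fun _ => hKpos) :
            VillainCurrentModel 3 L 1).twoPoint (x, 0) (y, 0) := H L K hKpos hK₀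
    _ = ∑ x : TorusSite 3 L, ∑ y : TorusSite 3 L, Q.twoPoint (x, 0) (y, 0) := by
        simp_rw [hQH]
    _ ≤ ∑ x : TorusSite 3 L, ∑ y : TorusSite 3 L, P.twoPoint (x, 0) (y, 0) :=
        Finset.sum_le_sum fun x _ => Finset.sum_le_sum fun y _ => Q.twoPoint_mono P hQP _ _

end Summit.AtomisticToContinuum.BoseEinsteinCondensation.Theorems

end
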